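import Mathlib
import Literature.Combinatorics.Additive.TripleProductProperty
import Literature.Computability.AlgebraicComplexity.GroupTheoreticMatMulThmBProofs
import Literature.Computability.AlgebraicComplexity.STPPLineFamilies
import Summits.MatrixMultiplication.MatrixMultiplication.Theorems.GroupTheoreticSTPPCThesisNoFour444Order125Lemmas

/-!
# No STPP family of four `(4,4,4)` triples in an abelian group of order `125`

Support file for route `MatrixMultiplication/GroupTheoreticSTPP`, crux `stmt-MatrixMultiplication-0597`,
cell `mm-stpp` (D-0046), CENSUS-PLAN §6 kill criterion K-F3 (b), second half
(memo `HOME/mm-stpp-eng-1/F3-PACKING-BOUND.md`, "Theorem B").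

The Neumann-type packing inequality of the companion file `GroupTheoreticSTPPCThesisNeumannPacking`
(`STPPNeumannPacking.isSTPP_card_le_four_of_order125`) leaves exactly one unit of slack for four STPP
triples of shape `(4,4,4)` in a group of order `125` (`2·4·4·16 = 128 ≤ 125 + 4`).  This file closes the
gap (it is self-contained: the case `N ≥ 5` is reduced to `N = 4` by passing to a sub-family, so the
packing inequality is not even needed):

* `isSTPP_card_le_three_of_order125` — in an abelian group `H` with `|H| = 125` (e.g. `ℤ₅³`, the
  census host `Cyc₅³`), an `IsSTPP` family of triples of shape `(4,4,4)` has at most `3` members.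

Proof: with `Q = ⋃(Bᵢ − Aᵢ)`, `R = ⋃(Cᵢ − Bᵢ)`, `P' = ⋃(Cᵢ − Aᵢ)` (64 elements each) and
`r(y) = #{q ∈ Q : y − q ∈ R}`: `∑ r = 64²` but `r ≤ 4` on `P'` (CKSU Def. 5.1), so the defects `64 − r(y)`
on the 61-set `F = H ∖ P'` sum to `≤ 64`; `r = 64` happens at most once (else `Q` is periodic, `5 ∤ 64`),
so `≥ 57` points `y ∈ F` have `r(y) ≥ 63` and their differences `t` have `|Q ∖ (Q + t)| ≤ 2`; this defect
is subadditive and the iterated sumsets of the difference set grow until they fill `H`, giving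
`|Q ∩ (Q + t)| ≥ 36` for every `t` — contradicting `∑_t |Q ∩ (Q + t)| = 64²`.  Counting lemmas and the
two group facts are in `GroupTheoreticSTPPCThesisNoFour444Order125Lemmas.lean`.

WHAT THIS IS NOT: no `ω` statement; nothing about three triples (k = 3 of shape `(4,4,4)` in `ℤ₅³` is
open: it would be a T_F row `τ = 2.6904`), nor about shapes other than `(4,4,4)`.
-/

-- single-conjunct summit: the mandated namespace repeats `MatrixMultiplication`.
set_option linter.dupNamespace false

namespace Summit.MatrixMultiplication.MatrixMultiplication.Theorems

namespace STPPNoFour444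

open Finset Literature.Combinatorics.Additive Literature.Computability.AlgebraicComplexity
open scoped Pointwise

variable {H : Type*} [AddCommGroup H] [Fintype H] [DecidableEq H]

/-! ### The core counting argument -/

/-- **Core lemma.** In an abelian group of order `125` there are no `Q, R, P' ⊆ H` of size `64` each whose
`64²` sums `q + r` (`q ∈ Q`, `r ∈ R`) hit `P'` at most `256` times (`∑_{y ∈ P'} #{q ∈ Q : y − q ∈ R} ≤ 256`);
the quotient sets of four `(4,4,4)` STPP triples would be such a configuration. [original] -/
theorem core (hH : Fintype.card H = 125) (Q R P' : Finset H) (hQ : Q.card = 64) (hR : R.card = 64)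
    (hP : P'.card = 64) (hsum : ∑ y ∈ P', (Q.filter fun q => y - q ∈ R).card ≤ 256) : False := by
  set r : H → ℕ := fun y => (Q.filter fun q => y - q ∈ R).card with hr
  set g : H → ℕ := fun t => (Q.filter fun q => q - t ∈ Q).card with hg
  set δ : H → ℕ := fun t => (Q.filter fun q => q - t ∉ Q).card with hδ
  have hgδ : ∀ t, g t + δ t = 64 := fun t => by
    have := card_filter_add_card_filter_not (s := Q) (fun q => q - t ∈ Q)
    rw [hQ] at this
    simpa only [hg, hδ] using this
  have htot : ∑ y, r y = 64 * 64 := by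
    have := sum_card_filter_sub_mem Q R
    rw [hQ, hR] at this
    simpa only [hr] using this
  set F := univ \ P' with hF
  have hFcard : F.card = 61 := by rw [hF, card_univ_sdiff, hH, hP]
  have hsumF : 3840 ≤ ∑ y ∈ F, r y := by
    have hsplit : (∑ y ∈ F, r y) + ∑ y ∈ P', r y = ∑ y, r y := by
      rw [hF]; exact sum_sdiff (subset_univ P')
    have hsum' : ∑ y ∈ P', r y ≤ 256 := by simpa only [hr] using hsum
    omega
  have hr_le : ∀ y, r y ≤ 64 := fun y => by
    have := card_filter_le Q (fun q => y - q ∈ R)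
    rw [hQ] at this
    simpa only [hr] using this
  have hall : ∀ z, r z = 64 → ∀ q ∈ Q, z - q ∈ R := by
    intro z hz q hq
    have heq : Q.filter (fun q => z - q ∈ R) = Q := by
      apply eq_of_subset_of_card_le (filter_subset _ _)
      rw [hQ]
      have : r z = (Q.filter (fun q => z - q ∈ R)).card := rfl
      omega
    have hq' : q ∈ Q.filter (fun q => z - q ∈ R) := by rw [heq]; exact hq
    exact (mem_filter.1 hq').2
  have hfull : ∀ y y', r y = 64 → r y' = 64 → y = y' := by
    intro y y' hy hy'
    have himg : Q.image (fun q => y - q) = R := by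
      apply eq_of_subset_of_card_le
      · intro x hx
        obtain ⟨q, hq, rfl⟩ := mem_image.1 hx
        exact hall y hy q hq
      · rw [hR, card_image_of_injective _ sub_right_injective, hQ]
    have htrans : ∀ q ∈ Q, q + (y - y') ∈ Q := by
      intro q hq
      have h1 : y' - q ∈ R := hall y' hy' q hq
      rw [← himg] at h1
      obtain ⟨q₁, hq₁, h1⟩ := mem_image.1 h1
      have : q + (y - y') = q₁ := by
        calc q + (y - y') = q + ((y - q₁) + q₁ - y') := by abel
          _ = q + ((y' - q) + q₁ - y') := by rw [h1]
          _ = q₁ := by abel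
      rw [this]; exact hq₁
    have h5 : ¬ 5 ∣ Q.card := by rw [hQ]; norm_num
    have := eq_zero_of_translate_subset hH Q h5 (y - y') htrans
    exact sub_eq_zero.1 this
  set F₁ := F.filter (fun y => 63 ≤ r y) with hF₁
  have hF₁card : 57 ≤ F₁.card := by
    set Z := F.filter (fun y => r y = 64) with hZ
    set B₂ := F.filter (fun y => ¬ 63 ≤ r y) with hB₂
    have hZ1 : Z.card ≤ 1 := by
      rw [card_le_one]
      intro y hy y' hy'
      exact hfull y y' (mem_filter.1 hy).2 (mem_filter.1 hy').2
    have hpt : ∀ y ∈ F, r y + (if ¬ 63 ≤ r y then 1 else 0) ≤ 63 + (if r y = 64 then 1 else 0) := by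
      intro y _
      have := hr_le y
      split_ifs <;> omega
    have hs := sum_le_sum hpt
    rw [sum_add_distrib, sum_add_distrib, sum_const, smul_eq_mul, hFcard, ← card_filter,
      ← card_filter] at hs
    have hsplit := card_filter_add_card_filter_not (s := F) (fun y => 63 ≤ r y)
    rw [hFcard] at hsplit
    have : B₂.card ≤ 4 := by
      have hB : (F.filter fun y => ¬ 63 ≤ r y).card = B₂.card := rfl
      have hZ' : (F.filter fun y => r y = 64).card = Z.card := rfl
      omega
    have hB' : (F.filter fun y => ¬ 63 ≤ r y).card = B₂.card := rfl
    have hF' : (F.filter fun y => 63 ≤ r y).card = F₁.card := rfl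
    omega
  have hδ2 : ∀ y ∈ F₁, ∀ y' ∈ F₁, δ (y - y') ≤ 2 := by
    intro y hy y' hy'
    have hy63 : 63 ≤ r y := (mem_filter.1 hy).2
    have hy'63 : 63 ≤ r y' := (mem_filter.1 hy').2
    set U := Q.filter (fun q => y - q ∈ R) with hU
    set U' := Q.filter (fun q => y' - q ∈ R) with hU'
    have hUc : 63 ≤ U.card := by simpa only [hr, hU] using hy63
    have hU'c : 63 ≤ U'.card := by simpa only [hr, hU'] using hy'63
    have h1 : (Q.filter fun q => q - (y - y') ∉ Q).card ≤
        (Q \ U).card + (U.filter fun q => q - (y - y') ∉ Q).card := by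
      calc (Q.filter fun q => q - (y - y') ∉ Q).card
          ≤ ((Q \ U) ∪ (U.filter fun q => q - (y - y') ∉ Q)).card := by
            refine card_le_card ?_
            intro q hq
            have hq' := mem_filter.1 hq
            by_cases hqU : q ∈ U
            · exact mem_union_right _ (mem_filter.2 ⟨hqU, hq'.2⟩)
            · exact mem_union_left _ (mem_sdiff.2 ⟨hq'.1, hqU⟩)
        _ ≤ (Q \ U).card + (U.filter fun q => q - (y - y') ∉ Q).card := card_union_le _ _
    have h2 : (Q \ U).card ≤ 1 := by
      have hUsub : U ⊆ Q := by rw [hU]; exact filter_subset _ _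
      rw [card_sdiff_of_subset hUsub, hQ]
      omega
    have h3 : (U.filter fun q => q - (y - y') ∉ Q).card ≤ 1 := by
      have himg : (U'.image fun q => y' - q) ⊆ R := by
        intro x hx
        obtain ⟨q', hq', rfl⟩ := mem_image.1 hx
        exact (mem_filter.1 hq').2
      have hcR : (R \ U'.image fun q => y' - q).card ≤ 1 := by
        rw [card_sdiff_of_subset himg, card_image_of_injective _ sub_right_injective, hR]
        omega
      refine le_trans ?_ hcR
      refine card_le_card_of_injOn (fun q => y - q) ?_ ?_
      · intro q hq
        rw [mem_coe, mem_filter] at hq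
        rw [mem_coe, mem_sdiff]
        refine ⟨(mem_filter.1 hq.1).2, ?_⟩
        intro hx
        obtain ⟨q', hq', hqq⟩ := mem_image.1 hx
        apply hq.2
        have : q - (y - y') = q' := by
          calc q - (y - y') = y' - (y - q) := by abel
            _ = y' - (y' - q') := by rw [hqq]
            _ = q' := by abel
        rw [this]
        exact (mem_filter.1 hq').1
      · intro q₁ _ q₂ _ h
        exact sub_right_injective h
    calc δ (y - y') = (Q.filter fun q => q - (y - y') ∉ Q).card := rfl
      _ ≤ 1 + 1 := h1.trans (Nat.add_le_add h2 h3)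
  have hF₁ne : F₁.Nonempty := card_pos.1 (by omega)
  obtain ⟨y₀, hy₀⟩ := hF₁ne
  set D₀ := F₁ - F₁ with hD₀
  have hD₀δ : ∀ t ∈ D₀, δ t ≤ 2 := by
    intro t ht
    rw [hD₀, mem_sub] at ht
    obtain ⟨y, hy, y', hy', rfl⟩ := ht
    exact hδ2 y hy y' hy'
  have h0D₀ : (0 : H) ∈ D₀ := by
    rw [hD₀, mem_sub]; exact ⟨y₀, hy₀, y₀, hy₀, sub_self _⟩
  have hD₀card : 57 ≤ D₀.card := by
    calc 57 ≤ F₁.card := hF₁card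
      _ = (F₁.image fun y => y - y₀).card := (card_image_of_injective _ (sub_left_injective)).symm
      _ ≤ D₀.card := by
          refine card_le_card ?_
          intro t ht
          obtain ⟨y, hy, rfl⟩ := mem_image.1 ht
          exact sub_mem_sub hy hy₀
  set S : ℕ → Finset H := fun j => (fun X : Finset H => X + D₀)^[j] {0} with hS
  have hS0 : S 0 = {0} := rfl
  have hSsucc : ∀ j, S (j + 1) = S j + D₀ := fun j => Function.iterate_succ_apply' _ _ _
  have hSδ : ∀ j, ∀ t ∈ S j, δ t ≤ 2 * j := by
    intro j
    induction j with
    | zero =>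
        intro t ht
        rw [hS0, mem_singleton] at ht
        subst ht
        have : (Q.filter fun q => q - 0 ∉ Q) = ∅ := by
          apply filter_false_of_mem
          intro q hq
          simpa using hq
        simp only [hδ, this, card_empty, mul_zero, le_refl]
    | succ j ih =>
        intro t ht
        rw [hSsucc, mem_add] at ht
        obtain ⟨s, hs, d, hd, rfl⟩ := ht
        calc δ (s + d) ≤ δ s + δ d := defect_subadd Q s d
          _ ≤ 2 * j + 2 := Nat.add_le_add (ih s hs) (hD₀δ d hd)
          _ = 2 * (j + 1) := by ring
  have hSmono : ∀ j, S j ⊆ S (j + 1) := fun j => by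
    rw [hSsucc]
    intro x hx
    rw [mem_add]
    exact ⟨x, hx, 0, h0D₀, add_zero x⟩
  have h0S : ∀ j, (0 : H) ∈ S j := fun j => by
    induction j with
    | zero => rw [hS0]; exact mem_singleton_self 0
    | succ j ih => exact hSmono j ih
  have hgrow : ∀ j, S j = univ ∨ 57 + j ≤ (S (j + 1)).card := by
    intro j
    induction j with
    | zero =>
        right
        rw [hSsucc, hS0, card_singleton_add]
        simpa using hD₀card
    | succ j ih =>
        by_cases huniv : S (j + 1) = univ
        · exact Or.inl huniv
        · right
          rcases ih with h | h
          · exact absurd (eq_univ_of_forall fun x => hSmono j (h ▸ mem_univ x)) huniv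
          · have hne : S (j + 1 + 1) ≠ S (j + 1) := by
              intro heq
              apply huniv
              refine eq_univ_of_add_subset hH D₀ (S (j + 1)) (by omega) ⟨0, h0S _⟩ ?_
              rw [← hSsucc, heq]
            have hss : S (j + 1) ⊂ S (j + 1 + 1) :=
              (hSmono (j + 1)).ssubset_of_ne (Ne.symm hne)
            have := card_lt_card hss
            omega
  have hS7 : S 7 = univ ∨ 63 ≤ (S 7).card := by
    rcases hgrow 6 with h | h
    · exact Or.inl (eq_univ_of_forall fun x => hSmono 6 (h ▸ mem_univ x))
    · exact Or.inr h
  have hT : S 7 + S 7 = univ := by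
    apply eq_univ_of_forall
    intro x
    rw [mem_add]
    rcases hS7 with h | h
    · exact ⟨x, by rw [h]; exact mem_univ x, 0, h0S 7, add_zero x⟩
    · -- pigeonhole: `S 7` meets `x - S 7`
      have hI : ((S 7) ∩ (S 7).image fun a => x - a).Nonempty := by
        rw [← card_pos]
        have h1 := card_inter_add_card_union (S 7) ((S 7).image fun a => x - a)
        have h2 : ((S 7) ∪ (S 7).image fun a => x - a).card ≤ 125 := by
          rw [← hH]; exact card_le_univ _
        rw [card_image_of_injective _ sub_right_injective] at h1
        omega
      obtain ⟨a, ha⟩ := hI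
      rw [mem_inter] at ha
      obtain ⟨b, hb, hba⟩ := mem_image.1 ha.2
      exact ⟨a, ha.1, b, hb, by rw [← hba]; abel⟩
  have hδall : ∀ t, δ t ≤ 28 := by
    intro t
    have ht : t ∈ S 7 + S 7 := by rw [hT]; exact mem_univ t
    rw [mem_add] at ht
    obtain ⟨a, ha, b, hb, rfl⟩ := ht
    calc δ (a + b) ≤ δ a + δ b := defect_subadd Q a b
      _ ≤ 2 * 7 + 2 * 7 := Nat.add_le_add (hSδ 7 a ha) (hSδ 7 b hb)
  have hgsum : ∑ t, g t = 64 * 64 := by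
    have := sum_card_filter_self Q
    rw [hQ] at this
    simpa only [hg] using this
  have hge : ∑ _t : H, (36 : ℕ) ≤ ∑ t, g t :=
    sum_le_sum fun t _ => by have := hgδ t; have := hδall t; omega
  rw [sum_const, smul_eq_mul, card_univ, hH] at hge
  omega

/-! ### The STPP statement -/

/-- Four `(4,4,4)` triples: the quotient sets of an `IsSTPP` family indexed by `Fin 4` in an abelian group
of order `125` satisfy the hypotheses of `core` — contradiction. [original] -/
theorem false_of_isSTPP_four (hH : Fintype.card H = 125) {A B C : Fin 4 → Finset H} (h : IsSTPP A B C)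
    (hA : ∀ i, (A i).card = 4) (hB : ∀ i, (B i).card = 4) (hC : ∀ i, (C i).card = 4) : False := by
  classical
  have hAne : ∀ i, (A i).Nonempty := fun i => card_pos.1 (by rw [hA i]; norm_num)
  have hBne : ∀ i, (B i).Nonempty := fun i => card_pos.1 (by rw [hB i]; norm_num)
  have hCne : ∀ i, (C i).Nonempty := fun i => card_pos.1 (by rw [hC i]; norm_num)
  set QD : Finset (Σ _ : Fin 4, H × H) := univ.sigma fun i => A i ×ˢ B i with hQD
  set RD : Finset (Σ _ : Fin 4, H × H) := univ.sigma fun j => B j ×ˢ C j with hRD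
  set PD : Finset (Σ _ : Fin 4, H × H) := univ.sigma fun k => C k ×ˢ A k with hPD
  set nq : (Σ _ : Fin 4, H × H) → H := fun z => -z.2.1 + z.2.2 with hnq
  set Q := QD.image nq with hQdef
  set R := RD.image nq with hRdef
  set P' := PD.image (fun z => -(nq z)) with hPdef
  have hinjQ : Set.InjOn nq ↑QD := by
    rintro ⟨i₁, a₁, b₁⟩ h₁ ⟨i₂, a₂, b₂⟩ h₂ (he : -a₁ + b₁ = -a₂ + b₂)
    simp only [hQD, coe_sigma, Set.mem_sigma_iff, coe_univ, Set.mem_univ, true_and, coe_product,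
      Set.mem_prod, mem_coe] at h₁ h₂
    obtain ⟨c, hc⟩ := hCne i₂
    have key : (a₁ - a₂) + (b₂ - b₁) + (c - c) = 0 := by
      have : b₁ = a₁ + (-a₂ + b₂) := by rw [← he]; abel
      rw [this]; abel
    obtain ⟨hij, -, hs, ht, -⟩ := h i₁ i₂ i₂ a₂ h₂.1 a₁ h₁.1 b₁ h₁.2 b₂ h₂.2 c hc c hc key
    subst hij; subst hs; subst ht; rfl
  have hinjR : Set.InjOn nq ↑RD := by
    rintro ⟨j₁, b₁, c₁⟩ h₁ ⟨j₂, b₂, c₂⟩ h₂ (he : -b₁ + c₁ = -b₂ + c₂)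
    simp only [hRD, coe_sigma, Set.mem_sigma_iff, coe_univ, Set.mem_univ, true_and, coe_product,
      Set.mem_prod, mem_coe] at h₁ h₂
    obtain ⟨a, ha⟩ := hAne j₂
    have key : (a - a) + (b₁ - b₂) + (c₂ - c₁) = 0 := by
      have : c₁ = b₁ + (-b₂ + c₂) := by rw [← he]; abel
      rw [this]; abel
    obtain ⟨hij, -, -, ht, hu⟩ := h j₂ j₁ j₂ a ha a ha b₂ h₂.1 b₁ h₁.1 c₁ h₁.2 c₂ h₂.2 key
    subst hij; subst ht; subst hu; rfl
  have hinjP : Set.InjOn (fun z => -(nq z)) ↑PD := by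
    rintro ⟨k₁, c₁, a₁⟩ h₁ ⟨k₂, c₂, a₂⟩ h₂ (he : -(-c₁ + a₁) = -(-c₂ + a₂))
    simp only [hPD, coe_sigma, Set.mem_sigma_iff, coe_univ, Set.mem_univ, true_and, coe_product,
      Set.mem_prod, mem_coe] at h₁ h₂
    obtain ⟨b, hb⟩ := hBne k₂
    have key : (a₂ - a₁) + (b - b) + (c₁ - c₂) = 0 := by
      have : a₁ = c₁ + (-c₂ + a₂) := by
        have he' : -c₁ + a₁ = -c₂ + a₂ := neg_injective he
        rw [← he']; abel
      rw [this]; abel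
    obtain ⟨-, hjk, hs, -, hu⟩ := h k₂ k₂ k₁ a₁ h₁.2 a₂ h₂.2 b hb b hb c₂ h₂.1 c₁ h₁.1 key
    subst hjk; subst hs; subst hu; rfl
  have h64 : ∀ (X Y : Fin 4 → Finset H), (∀ i, (X i).card = 4) → (∀ i, (Y i).card = 4) →
      (univ.sigma fun i => X i ×ˢ Y i).card = 64 := by
    intro X Y hX hY
    rw [card_sigma]
    simp [card_product, hX, hY]
  have hQ : Q.card = 64 := by rw [hQdef, card_image_of_injOn hinjQ, hQD, h64 A B hA hB]
  have hR : R.card = 64 := by rw [hRdef, card_image_of_injOn hinjR, hRD, h64 B C hB hC]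
  have hP : P'.card = 64 := by rw [hPdef, card_image_of_injOn hinjP, hPD, h64 C A hC hA]
  refine core hH Q R P' hQ hR hP ?_
  have hfib : ∀ y ∈ P', (Q.filter fun q => y - q ∈ R).card ≤ 4 := by
    intro y hy
    rw [hPdef, mem_image] at hy
    obtain ⟨⟨k, c, a⟩, hz, rfl⟩ := hy
    rw [hPD] at hz
    simp only [mem_sigma, mem_univ, true_and, mem_product] at hz
    refine le_trans ?_ (hB k).le
    refine card_le_card_of_injOn (fun q => a + q) ?_ ?_
    · intro q hq
      rw [mem_coe, mem_filter, hQdef, mem_image] at hq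
      obtain ⟨⟨⟨i, a₁, b₁⟩, hq₁, rfl⟩, hqR⟩ := hq
      rw [hRdef, mem_image] at hqR
      obtain ⟨⟨j, b₂, c₂⟩, hq₂, he⟩ := hqR
      rw [hQD] at hq₁; rw [hRD] at hq₂
      simp only [mem_sigma, mem_univ, true_and, mem_product] at hq₁ hq₂
      simp only [hnq] at he ⊢
      have key : (a₁ - a) + (b₂ - b₁) + (c - c₂) = 0 := by
        have : c₂ = b₂ + (-(-c + a) - (-a₁ + b₁)) := by rw [← he]; abel
        rw [this]; abel
      obtain ⟨hij, hjk, hs, ht, -⟩ := h i j k a hz.2 a₁ hq₁.1 b₁ hq₁.2 b₂ hq₂.1 c₂ hq₂.2 c hz.1 key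
      subst hij; subst hjk; subst hs
      rw [mem_coe, ← add_assoc, add_neg_cancel, zero_add]
      exact hq₁.2
    · intro q₁ _ q₂ _ hq
      exact add_right_injective a hq
  calc ∑ y ∈ P', (Q.filter fun q => y - q ∈ R).card ≤ ∑ _y ∈ P', 4 := sum_le_sum hfib
    _ = 256 := by rw [sum_const, smul_eq_mul, hP]

/-- **Theorem B (cell mm-stpp).** In an abelian group `H` of order `125` — e.g. `ℤ₅³`, the census
host `Cyc₅³` — an STPP family (census predicate `IsSTPP`) of triples of shape `(4,4,4)` has at most
three members (a sub-family of four would contradict `false_of_isSTPP_four`). [original] -/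
theorem isSTPP_card_le_three_of_order125 (hH : Fintype.card H = 125) {N : ℕ}
    {A B C : Fin N → Finset H} (h : IsSTPP A B C) (hA : ∀ i, (A i).card = 4)
    (hB : ∀ i, (B i).card = 4) (hC : ∀ i, (C i).card = 4) : N ≤ 3 := by
  by_contra hN
  have h4 : 4 ≤ N := by omega
  have h' := h.comp_of_injective (Fin.castLE h4) (Fin.castLE_injective h4)
  exact false_of_isSTPP_four hH h' (fun i => hA _) (fun i => hB _) (fun i => hC _)

/-- The `ℤ₅³` instance (census host `Cyc₅³`, `H = Fin 3 → ZMod 5`): no `IsSTPP` family of four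
`(4,4,4)` triples — kill criterion K-F3 (b), second clause, by theorem. [original] -/
theorem no_isSTPP_four_444_zmod5_cube (A B C : Fin 4 → Finset (Fin 3 → ZMod 5))
    (hA : ∀ i, (A i).card = 4) (hB : ∀ i, (B i).card = 4) (hC : ∀ i, (C i).card = 4) :
    ¬ IsSTPP A B C := by
  intro h
  have hH : Fintype.card (Fin 3 → ZMod 5) = 125 := by simp
  exact false_of_isSTPP_four hH h hA hB hC

end STPPNoFour444

end Summit.MatrixMultiplication.MatrixMultiplication.Theorems
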